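import Summits.QuantumFields.BalabanUV.Beta.D1BFx.LocalVertexBound

/-!
# `BalabanUV.Beta.D1BFx.LocalVertexFormLeft` — road «BF-x» for binder row D1, slot (K), END row `hGrp gN`, «GN-T12 ∕ FRAME» part 3: THE TRANSPOSED
# PLACEMENT — a RANK-ONE kernel in the FIRST slot against a LOCAL LIST VERTEX in the second: `biBubble A (φ ⊗ ψ) B (realK z z L) = vtx z L (ψB) (Aφ)`
# and `|biBubble A (φ ⊗ ψ) B (SbT κ u)| ≤ K·(Φ₁Γ₀ + Φ₀Γ₁ + Φ₁Γ₁)` with the SAME absolute `K`, `R` — the frame of the three T₂ pieces `· ⊗ SbT`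
# (`GluonNeedleGlueT12.h₂_of_pieces`)

HONEST DEPENDENCY (cell records, verbatim): «continuum YM on T⁴ ⇐ BetaPertH ∧ nine spine estimates (0/9 proved); BetaPertH ⇐ (D1) ∧ (D4) ∧
CAP+tail; G-an2-4 gates asym, D1 and NE2/3/4.»  HONEST FRAMING (cell contract, verbatim): «discharging `BetaPertH` makes Bałaban's UV stability
UNCONDITIONAL — a real constructive-QFT result; it is NOT the continuum limit and NOT the Clay problem.»  THIS MODULE DISCHARGES NOTHING of the
wall: [folklore] finite-sum bookkeeping over parts 1–2 (`LocalVertexForm`: `vform`, `vtx`, `vform_realK`, `exists_vtx_bound_of_graded_one`; `RankOneBubble`: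
`comp_outer_right`, `comp_outer_left`, `tr_outer`; `FiniteStencilCalculus`: `comp_eq_sum_of_rowSupp`, `comp_eq_zero_of_colSupp_right`) and leaf-03-g12's
`GluonBubbleTails` (`SbT_eq_realK`, `graded_SbT_list`).  ONE summability hypothesis on the row end `y ↦ Σ_a ψ y a · B y r a g` (one
`Summable.tsum_finsetSum`).  No `def`, no `def … : Prop`, nothing cited, 0 sorry.  Asserts NO bound on any table of the road.  Root-level binders
hW ∕ hR-sockets ∕ hSX-socket ∕ D1Tel ∕ D1Rep — 0 discharged; (K) NOT closed; NOT D1, NOT `BetaPertH`, NOT continuum, NOT Clay.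

ABSOLUTE RULE (cell charter, verbatim): «No internally-minted statement may enter as a cited fact. Every hypothesis is either kernel-proved in
this package or a verbatim quotation of a PUBLISHED theorem with page reference. The manuscript(s) under audit are NOT citable for their own
disputed steps — they are the thing under adjudication; programme-internal (2001/route/tribunal) claims are never citable.»

WHY (owner records `HOME/b2b-balaban-beta-d1-p2/GLUON-NEEDLE-ROWS.md` v0.2; RULING ρ-g10-8 tally).  T₂'s pieces are `cellSum n a (piece) SbT` — the rank-one
partner sits in the FIRST stencil slot (`biBubbleTable Ga Ga piece SbT μ ν (b+w) b = −½·biBubble Ga (piece μ (b+w)) Ga (SbT ν b)`).  In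
`tr((A·(φ⊗ψ))·(B·V)) = tr((Aφ) ⊗ (ψ(B·V))) = ⟨Aφ, ψ(B V)⟩` the list `V` now meets the row end `ψB` (contracted at the list's ROW sites) and the column
end `Aφ` (at its COLUMN sites): the same vertex form `vtx z L (ψB) (Aφ)`, hence the same graded unfolding and the same window estimate.
* §1 [folklore] `applyKT_comp_eq_sum`, **`biBubble_outer_left_eq_vform`**, **`biBubble_outer_realK`**.
* §2 [folklore] **`exists_SbT_outer_bound_left`** (absolute `K`, `R`; windows around `u` for `ψB` ∣ `Aφ`).
NOT HERE (honest): any letter or cell.  Unit `b2b-balaban-beta-d1-p2` (gen 10), road «BF-x» OWNER; `LEAVES-BFx.md` row (N) «GN-T12 ∕ FRAME» part 3.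
-/

noncomputable section

namespace Summit.QuantumFields.BalabanUV.Beta.D1BFx.LocalVertexForm

open Finset
open scoped BigOperators
open Literature.MathematicalPhysics.QuantumFieldTheory.Balaban1983to89
open Literature.MathematicalPhysics.QuantumFieldTheory.Balaban1983to89.Beta
open ExpKernelCalculus (Site MKer comp tr)
open DyadicShell (Pt supNorm)
open BubbleTransfer (unitVec)
open GradedBubbles (LP Stn Graded IsStep)
open Summit.QuantumFields.BalabanUV.Beta.D1BFx.FiniteStencilCalculus (comp_eq_sum_of_rowSupp comp_eq_zero_of_colSupp_right)
open Summit.QuantumFields.BalabanUV.Beta.D1BFx.StencilRealisation (realK realK_rowSupp realK_colSupp)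
open Summit.QuantumFields.BalabanUV.Beta.D1BFx.WilsonStencilRealised (reixStn ιU)
open Summit.QuantumFields.BalabanUV.Beta.D1BFx.CrossERestLists (vec₀ rem₀)
open Summit.QuantumFields.BalabanUV.Beta.D1BFx.SectorRecut (SbT)
open Summit.QuantumFields.BalabanUV.Beta.D1BFx.GluonBubbleTails (SbT_eq_realK graded_SbT_list)
open Summit.QuantumFields.BalabanUV.Beta.D1BFx.PackedKernelSplit (biBubble)
open Summit.QuantumFields.BalabanUV.Beta.D1BFx.RankOneBubble (outer applyK applyKT pairing comp_outer_right comp_outer_left tr_outer applyK_apply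
  applyKT_apply pairing_def)

variable {I : Type*} [Fintype I]

/-! ## §1 The transposed placement is the same vertex form -/

section Left

/-- [folklore] **A ROW END THROUGH A FINITELY SUPPORTED KERNEL**: `(ψ(B·V))(z, b) = Σ_{r∈S} Σ_g V r z g b · (ψB)(r, g)` (`comp_eq_sum_of_rowSupp` over the
row support; ONE exchange of the lattice series in `y` with the finite vertex sums by the summability of `y ↦ Σ_a ψ y a · B y r a g`). -/
theorem applyKT_comp_eq_sum (B V : MKer 4 I) {S : Finset Pt} (hS : ∀ y z f b, y ∉ S → V y z f b = 0) (ψ : Pt → I → ℝ)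
    (hψB : ∀ (r : Pt) (g : I), Summable fun y : Pt => ∑ a, ψ y a * B y r a g) (z : Pt) (b : I) :
    applyKT ψ (comp B V) z b = ∑ r ∈ S, ∑ g, V r z g b * applyKT ψ B r g := by
  rw [applyKT_apply]
  have hpt : ∀ y : Pt, (∑ a, ψ y a * comp B V y z a b) = ∑ r ∈ S, ∑ g, V r z g b * ∑ a, ψ y a * B y r a g := by
    intro y
    simp_rw [comp_eq_sum_of_rowSupp B V hS y z, mul_sum]
    rw [sum_comm]
    refine sum_congr rfl fun r _ => ?_
    rw [sum_comm]
    exact sum_congr rfl fun g _ => sum_congr rfl fun a _ => by ring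
  simp_rw [hpt]
  have h1 : ∀ (r : Pt) (g : I), Summable fun y : Pt => V r z g b * ∑ a, ψ y a * B y r a g := fun r g => (hψB r g).mul_left _
  have h2 : ∀ r : Pt, Summable fun y : Pt => ∑ g, V r z g b * ∑ a, ψ y a * B y r a g := fun r => summable_sum fun g _ => h1 r g
  rw [Summable.tsum_finsetSum fun r _ => h2 r]
  refine sum_congr rfl fun r _ => ?_
  rw [Summable.tsum_finsetSum fun g _ => h1 r g]
  refine sum_congr rfl fun g _ => ?_
  rw [tsum_mul_left, applyKT_apply]

/-- [folklore] **THE MIXED TWO-LEG BUBBLE, TRANSPOSED PLACEMENT — a RANK-ONE partner `φ ⊗ ψ` in the first slot against a finitely supported vertex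
`V` in the second — IS THE VERTEX FORM with row end `ψB` and column end `Aφ`**: `biBubble A (φ ⊗ ψ) B V = Σ_{s,y,g,f} V s y g f · (ψB)(s,g) · (Aφ)(y,f)`
(`comp_outer_right`, `comp_outer_left`, `tr_outer` unconditional; `tsum_eq_sum` over the column support). -/
theorem biBubble_outer_left_eq_vform (A V B : MKer 4 I) {S T : Finset Pt} (hS : ∀ y z f b, y ∉ S → V y z f b = 0)
    (hT : ∀ y z f b, z ∉ T → V y z f b = 0) (φ ψ : Pt → I → ℝ) (hψB : ∀ (r : Pt) (g : I), Summable fun y : Pt => ∑ a, ψ y a * B y r a g) :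
    biBubble A (outer φ ψ) B V = vform V S T (applyKT ψ B) (applyK A φ) := by
  unfold PackedKernelSplit.biBubble
  rw [comp_outer_right A, comp_outer_left, tr_outer, pairing_def]
  -- outside the column support the row end through `B·V` vanishes
  have hzero : ∀ z ∉ T, ∀ b : I, applyKT ψ (comp B V) z b = 0 := by
    intro z hz b
    rw [applyKT_apply]
    exact (tsum_congr fun y => Finset.sum_eq_zero fun a _ => by
      rw [comp_eq_zero_of_colSupp_right B V hT y z hz a b, mul_zero]).trans tsum_zero
  rw [tsum_eq_sum (s := T) fun z hz => Finset.sum_eq_zero fun b _ => by rw [hzero z hz b, mul_zero]]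
  unfold vform
  conv_rhs => rw [Finset.sum_comm]
  refine sum_congr rfl fun z _ => ?_
  simp_rw [applyKT_comp_eq_sum B V hS ψ hψB z, mul_sum]
  rw [Finset.sum_comm]
  refine sum_congr rfl fun r _ => ?_
  rw [Finset.sum_comm]
  exact sum_congr rfl fun g _ => sum_congr rfl fun b _ => by ring

/-- [folklore] **THE MIXED BUBBLE, TRANSPOSED PLACEMENT, OF A REALISED LIST**: `biBubble A (φ ⊗ ψ) B (realK z z L) = vtx z L (ψB) (Aφ)`
(one summability hypothesis on the row end `ψB`). -/
theorem biBubble_outer_realK (A B : MKer 4 I) (z : Pt) (L : Stn I) (φ ψ : Pt → I → ℝ)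
    (hψB : ∀ (r : Pt) (g : I), Summable fun y : Pt => ∑ a, ψ y a * B y r a g) :
    biBubble A (outer φ ψ) B (realK z z L) = vtx z L (applyKT ψ B) (applyK A φ) := by
  rw [biBubble_outer_left_eq_vform A (realK z z L) B (realK_rowSupp z z L) (realK_colSupp z z L) φ ψ hψB,
    vform_realK z L subset_rfl subset_rfl]

end Left

/-! ## §2 The frame of the three T₂ pieces: a rank-one partner in the first slot against `SbT` in the second -/

section SbTLeft

/-- [folklore] **THE FRAME OF THE THREE `· ⊗ SbT` PIECES OF T₂ — A RANK-ONE PARTNER AGAINST THE TRANSVERSE WILSON SECTOR IN THE SECOND SLOT.**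
There are `K ≥ 0` and a window radius `R` (absolute) such that for every bond `(κ, u)`, all legs `A`, `B`, every rank-one partner `φ ⊗ ψ` whose row end
`ψB` is termwise summable, and all window bounds `Φ₀ ∕ Φ₁` (values ∕ forward unit differences of the row end `ψB` on `‖q − u‖∞ ≤ R`) and `Γ₀ ∕ Γ₁`
(of the column end `Aφ`):  `|biBubble A (φ ⊗ ψ) B (SbT κ u)| ≤ K · (Φ₁·Γ₀ + Φ₀·Γ₁ + Φ₁·Γ₁)`. -/
theorem exists_SbT_outer_bound_left :
    ∃ (K : ℝ) (R : ℕ), 0 ≤ K ∧ ∀ (κ : Fin 4) (u : Pt) (A B : MKer 4 (Fin 4)) (φ ψ : Pt → Fin 4 → ℝ),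
      (∀ (r : Pt) (g : Fin 4), Summable fun y : Pt => ∑ a, ψ y a * B y r a g) →
      ∀ (Φ₀ Φ₁ Γ₀ Γ₁ : ℝ), 0 ≤ Φ₀ → 0 ≤ Φ₁ → 0 ≤ Γ₀ → 0 ≤ Γ₁ →
      (∀ (q : Pt) (g : Fin 4), supNorm (q - u) ≤ R → |applyKT ψ B q g| ≤ Φ₀) →
      (∀ (q : Pt) (g : Fin 4) (i : Fin 4), supNorm (q - u) ≤ R → |applyKT ψ B (q + unitVec i) g - applyKT ψ B q g| ≤ Φ₁) →
      (∀ (q : Pt) (f : Fin 4), supNorm (q - u) ≤ R → |applyK A φ q f| ≤ Γ₀) →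
      (∀ (q : Pt) (f : Fin 4) (i : Fin 4), supNorm (q - u) ≤ R → |applyK A φ (q + unitVec i) f - applyK A φ q f| ≤ Γ₁) →
      |biBubble A (outer φ ψ) B (SbT κ u)| ≤ K * (Φ₁ * Γ₀ + Φ₀ * Γ₁ + Φ₁ * Γ₁) := by
  have h := fun κ : Fin 4 => exists_vtx_bound_of_graded_one (I := Fin 4) (graded_SbT_list κ)
  choose K R hK hb using h
  refine ⟨∑ κ, K κ, Finset.univ.sup R, sum_nonneg fun κ _ => hK κ,
    fun κ u A B φ ψ hψB Φ₀ Φ₁ Γ₀ Γ₁ h0 h1 h2 h3 hF₀ hF₁ hG₀ hG₁ => ?_⟩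
  rw [SbT_eq_realK, biBubble_outer_realK A B u _ φ ψ hψB]
  have hRκ : R κ ≤ Finset.univ.sup R := Finset.le_sup (mem_univ κ)
  have hS : 0 ≤ Φ₁ * Γ₀ + Φ₀ * Γ₁ + Φ₁ * Γ₁ := by positivity
  refine (hb κ u _ _ Φ₀ Φ₁ Γ₀ Γ₁ h0 h1 h2 h3 (fun q g hq => hF₀ q g (hq.trans hRκ)) (fun q g i hq => hF₁ q g i (hq.trans hRκ))
    (fun q f hq => hG₀ q f (hq.trans hRκ)) (fun q f i hq => hG₁ q f i (hq.trans hRκ))).trans ?_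
  exact mul_le_mul_of_nonneg_right (single_le_sum (f := K) (fun κ _ => hK κ) (mem_univ κ)) hS

end SbTLeft

end Summit.QuantumFields.BalabanUV.Beta.D1BFx.LocalVertexForm
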